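import Summits.Ventures.Crystal3D.Bulk.RadiusTwoBarlowHolds
import Summits.Ventures.Crystal3D.Bulk.BulkOfGapComputational
import Summits.Ventures.Crystal3D.Bulk.BulkOfTammes
import Summits.Ventures.Crystal3D.Bulk.BulkOfGap125
import HarnessLib

/-!
# Positional order (W-2P) on each route to `BulkCrystallization3D 702` — closed terms

HONEST FRAMING. Part of the venture `Summits/Ventures/Crystal3D` (cell `pub-crystal3d`, phase 2). PURE
BOOKKEEPING: with the radius-2 lemma proved (`radiusTwoBarlow_holds`, `Bulk/RadiusTwoBarlowHolds.lean`,
standard axioms) the positional corollary `positionalOrder_of_bulk'` composes with each route to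
`BulkCrystallization3D 702` that the tree holds. Each closed term below carries EXACTLY the hypothesis
and the axiom grade of its route — and EVERY row is at COMPUTATIONAL grade: rows 1–4 reach the sharp
constant `702` through `kissingClassification_two_mul_hales_h0_holds` (Hales 2012's kissing-configuration
search: the 128 `native_decide` facts `KissingSearch.checkPart_eq_true_000…127`, «K12»), row 5 through
`gapTupleDiam_125` (the W0625 cap cover: 67 `native_decide` facts `CapX2.checkII/checkIII_*_W0625`, and NO
K12 fact — there the classification side is the hypothesis). The standard-axiom reading of Hales's route is
`positionalOrder_of_hales` at `157 · 1296` (`Bulk/RadiusTwoBarlowHolds.lean`). Nothing is discharged here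
and no number of the DECISION moves. GAP(1.26) itself is NOT claimed. (Module docstring amended 2026-08-25
by seat p3 g13 on the red team's LANDING AUDIT #20 grade note; statements and proofs byte-identical to
the landed p390802.)

* `positionalOrder_of_twelveNeighbourGap` — GAP(1.26), twelve-neighbour form ⇒ W-2P with `157 · 702`
  (computational grade: the 128 K12 natives of `bulkCrystallization3D_sharp_of_twelveNeighbourGap`).
* `positionalOrder_of_flyspeck_L12` — Hales's `flyspeck_L12` (HOL-Light named fact) ⇒ the same, at the
  same computational grade (128 K12 natives).
* `positionalOrder_of_tammes13` — Musin–Tarasov's Tammes(13) (named fact) ⇒ the same (128 K12 natives).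
* `positionalOrder_of_noHole_063` — the angular currency `NoHole 0.63` ⇒ the same (128 K12 natives).
* `positionalOrder_of_kissingClassification_250` — the `h = 5/4` K-path: BIMODAL(1.25) =
  `KissingClassification (5/2)` ⇒ the same (computational grade: exactly the 67 W0625 cover natives of
  `gapTupleDiam_125`; no K12 native).
-/

noncomputable section

namespace Summit.Ventures.Crystal3D

open Literature.Geometry.DiscreteGeometry

variable {N : ℕ}

/-- **W-2P from GAP(1.26)** (twelve-neighbour form at `h₀ = 1.26`): all but `157 · 702 · N^{2/3}` balls of
every sticky ground state are centres of Barlow radius-2 patches. -/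
theorem positionalOrder_of_twelveNeighbourGap (h : TwelveNeighbourGap hales_h0)
    (x : Fin N → EuclideanSpace ℝ (Fin 3)) (hx : IsStickyGroundState x) :
    ((nonBarlowCentre x).card : ℝ) ≤ 157 * 702 * (N : ℝ) ^ ((2 : ℝ) / 3) :=
  positionalOrder_of_bulk' (bulkCrystallization3D_sharp_of_twelveNeighbourGap h) x hx

/-- **W-2P from Hales's Lemma `L12`** (`flyspeck_L12`, HOL-Light named fact). -/
theorem positionalOrder_of_flyspeck_L12 (hL12 : flyspeck_L12)
    (x : Fin N → EuclideanSpace ℝ (Fin 3)) (hx : IsStickyGroundState x) :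
    ((nonBarlowCentre x).card : ℝ) ≤ 157 * 702 * (N : ℝ) ^ ((2 : ℝ) / 3) :=
  positionalOrder_of_bulk' (bulkCrystallization3D_sharp_of_flyspeck_L12 hL12) x hx

/-- **W-2P from Tammes(13)** (Musin–Tarasov 2012, named fact). -/
theorem positionalOrder_of_tammes13 (hMT : musinTarasov2012_tammes_thirteen)
    (x : Fin N → EuclideanSpace ℝ (Fin 3)) (hx : IsStickyGroundState x) :
    ((nonBarlowCentre x).card : ℝ) ≤ 157 * 702 * (N : ℝ) ^ ((2 : ℝ) / 3) :=
  positionalOrder_of_bulk' (TammesBridge.bulkCrystallization3D_sharp_of_tammes13 hMT) x hx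

/-- **W-2P from the angular cut `NoHole 0.63`** (the census's currency). -/
theorem positionalOrder_of_noHole_063 (hAG : NoHole 0.63)
    (x : Fin N → EuclideanSpace ℝ (Fin 3)) (hx : IsStickyGroundState x) :
    ((nonBarlowCentre x).card : ℝ) ≤ 157 * 702 * (N : ℝ) ^ ((2 : ℝ) / 3) :=
  positionalOrder_of_bulk' (TammesBridge.bulkCrystallization3D_sharp_of_noHole hAG) x hx

/-- **W-2P on the `h = 5/4` K-path**: BIMODAL(1.25) = `KissingClassification (5/2)` ⇒ all but
`157 · 702 · N^{2/3}` balls of every sticky ground state are centres of Barlow radius-2 patches. -/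
theorem positionalOrder_of_kissingClassification_250 (hc : KissingClassification (5 / 2))
    (x : Fin N → EuclideanSpace ℝ (Fin 3)) (hx : IsStickyGroundState x) :
    ((nonBarlowCentre x).card : ℝ) ≤ 157 * 702 * (N : ℝ) ^ ((2 : ℝ) / 3) :=
  positionalOrder_of_bulk' (bulkCrystallization3D_sharp_of_kissingClassification_250 hc) x hx

end Summit.Ventures.Crystal3D
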